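import Summits.CriticalPhenomena.PercolationContinuityZ3.Theorems.PercNearOneGluingNoHeavyLowerTailSahiMeetTowerAllOrders
import Literature.Combinatorics.Sahi2008.FixedCycle
import Mathlib.Data.Finset.Sort
import Mathlib.Data.Fin.Embedding
import Mathlib.Algebra.BigOperators.Fin
import Mathlib.Algebra.BigOperators.Group.Finset.Sigma
import Mathlib.Data.Nat.Factorial.Basic
import Mathlib.Tactic.Linarith
import Mathlib.Tactic.Ring
import HarnessLib

/-!
# `NoHeavyLowerTail` (stmt-CriticalPhenomena-4575) — the block (moment) expansion of Sahi's `E_n` in the HEAD SLOT, recursion form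

Support file, seat `prim-l12-p5` (gen 4), `--supports stmt-CriticalPhenomena-4575`.  No definitions, no named facts, no sorries.
Companion (uses this file): `…SahiDefectExpansion` — the DEFECT form of the expansion and its positivity consequences for all orders
(hereditary positivity + a slot absorbing the total meet; all-order versions of the certificates C′ / `sahiE_four_ge_meet_defect`).

**Notation.**  For `g : Fin N → (α → ℝ)` and `S : Finset (Fin N)` the SUB-FAMILY functional `E_{|S|}(g|S)` is written
`sahiE μ S.card (fun j => g (S.orderEmbOfFin rfl j))` (increasing enumeration of `S`; by the symmetry of `E_n` the value does not depend
on the enumeration — `subfamily_eq_cycleSum` identifies it with Lieb–Sahi's cycle sum `CycleForm.cycleSum μ (fun j : S => g j)` of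
`Literature/Combinatorics/Sahi2008/FixedCycle.lean`).  Bookkeeping: `sahiE_cast`, `subfamily_congr`, `subfamily_univ`,
`subfamily_map_succAbove` (sub-families of `p.removeNth g`), `subfamily_compl_singleton`.

**The expansion** (`sahiE_cons_eq_moment_expansion`; any weight `μ`, any functions `x, g_0,…,g_m`):

  `E_{m+2}(x, g) = (m+1)!·E[x·∏_i g_i] − E[x]·E_{m+1}(g) − Σ_{∅ ≠ T ⊊ univ} |T|!·E[x·∏_{i∈T} g_i]·E_{|Tᶜ|}(g|Tᶜ)`,

uniform form `sahiE_cons_eq_moment_expansion_aux` (the block `T = ∅` is the middle term).  This is Lieb–Sahi's fixed-cycle formula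
[J. Math. Phys. 63 (2022), Prop. 3.4 and p. 8] summed over the cycles through the head slot — in the tree already available in cycle form as
`Literature…CycleForm.sahiE_eq_sum_blocks` (with `coRest`).  Here it is RE-DERIVED for the tree's recursive `sahiE` in `Fin.cons` form, by
induction on the Lieb–Sahi recursion (`sahiE_fin_cons`) and symmetry (`SahiMeetTowerAll.sahiE_update_eq_sahiE_cons`): peel `x`, expand each
`E_{m+1}(g with g_p ↦ g_p·x)` by the induction hypothesis with `g_p·x` moved to the head, and regroup the blocks through the pivot `p`
(`sum_blocks_succAbove`: `T = insert p (T'.map (succAboveEmb p))`, the `|T|` choices of the pivot turn `(|T|−1)!` into `|T|!`).  This second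
route needs no cycle machinery and delivers the statement directly in the `Fin.cons`/`Finset` vocabulary of the hierarchy-identity files.

**Consequences recorded here.**  `sahiE_one_cons_eq`: unnormalised branching `E_{m+2}(1, g) = (m + 1 − E[1])·E_{m+1}(g)` (Sahi's Thm 6 for a
probability weight); `sahiE_moment_recursion`: `(m+1)·E_{m+1}(g) = (m+1)!·E[∏ g] − Σ_{∅≠T⊊univ} |T|!·E[∏_T g]·E_{|Tᶜ|}(g|Tᶜ)` — `E_{m+1}` from
the top moment and the lower-order functionals of the sub-families.
Pre-check (exact rationals, seat `code/moment_expansion_check.py`): 300 random instances, `m ≤ 5`, arbitrary signed weights, 0 mismatches.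
-/

namespace Summit.CriticalPhenomena.PercolationContinuityZ3.Theorems

namespace SahiMomentExpansion

open Finset Function Literature.Combinatorics.Sahi2008
open scoped Nat

variable {α : Type*} [Fintype α]

/-! ### Sub-families `g|S` (indexed by `S` in increasing order): casts and re-indexing -/

/-- Transport of `E_k` along a cast `Fin k → Fin k'` of the index type (`k = k'`). [folklore] -/
theorem sahiE_cast (μ : α → ℝ) {k k' : ℕ} (h : k = k') (F : Fin k' → α → ℝ) :
    sahiE μ k (fun j => F (Fin.cast h j)) = sahiE μ k' F := by
  subst h
  rfl

/-- Equal index sets give equal sub-family functionals (dependent rewriting helper). [folklore] -/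
theorem subfamily_congr (μ : α → ℝ) {N : ℕ} {S₁ S₂ : Finset (Fin N)} (h : S₁ = S₂) (g : Fin N → α → ℝ) :
    sahiE μ S₁.card (fun j => g (S₁.orderEmbOfFin rfl j))
      = sahiE μ S₂.card (fun j => g (S₂.orderEmbOfFin rfl j)) := by
  subst h
  rfl

/-- The full index set gives back the family: `E(g|univ) = E_N(g)`. [folklore] -/
theorem subfamily_univ (μ : α → ℝ) {N : ℕ} (g : Fin N → α → ℝ) :
    sahiE μ (univ : Finset (Fin N)).card (fun j => g ((univ : Finset (Fin N)).orderEmbOfFin rfl j))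
      = sahiE μ N g := by
  have hc : N = (univ : Finset (Fin N)).card := (Finset.card_fin N).symm
  rw [← sahiE_cast μ hc]
  congr 1
  funext j
  have e1 : (univ : Finset (Fin N)).orderEmbOfFin rfl (Fin.cast hc j)
      = (univ : Finset (Fin N)).orderEmbOfFin (Finset.card_fin N) j :=
    Finset.orderEmbOfFin_eq_orderEmbOfFin_iff.mpr rfl
  have e2 : (fun j : Fin N => j) = (univ : Finset (Fin N)).orderEmbOfFin (Finset.card_fin N) :=
    Finset.orderEmbOfFin_unique _ (fun j => mem_univ j) strictMono_id
  have e2' : j = (univ : Finset (Fin N)).orderEmbOfFin (Finset.card_fin N) j := congrFun e2 j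
  rw [e1, ← e2']

/-- Sub-family along `succAbove`: the sub-family of `g` indexed by `S'.map (succAboveEmb p)` is the sub-family of
`p.removeNth g` indexed by `S'`. [folklore] -/
theorem subfamily_map_succAbove (μ : α → ℝ) {n : ℕ} (p : Fin (n + 1)) (S' : Finset (Fin n))
    (g : Fin (n + 1) → α → ℝ) :
    sahiE μ (S'.map (Fin.succAboveEmb p)).card
        (fun j => g ((S'.map (Fin.succAboveEmb p)).orderEmbOfFin rfl j))
      = sahiE μ S'.card (fun j => p.removeNth g (S'.orderEmbOfFin rfl j)) := by
  have hc : S'.card = (S'.map (Fin.succAboveEmb p)).card := (card_map _).symm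
  rw [← sahiE_cast μ hc]
  congr 1
  funext j
  have e1 : (S'.map (Fin.succAboveEmb p)).orderEmbOfFin rfl (Fin.cast hc j)
      = (S'.map (Fin.succAboveEmb p)).orderEmbOfFin (card_map _) j :=
    Finset.orderEmbOfFin_eq_orderEmbOfFin_iff.mpr rfl
  have e2 : (fun j => p.succAbove (S'.orderEmbOfFin rfl j))
      = (S'.map (Fin.succAboveEmb p)).orderEmbOfFin (card_map _) :=
    Finset.orderEmbOfFin_unique _ (fun j => (Finset.mem_map' (Fin.succAboveEmb p)).mpr (orderEmbOfFin_mem _ _ _))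
      ((Fin.strictMono_succAbove p).comp (S'.orderEmbOfFin rfl).strictMono)
  have e2' : p.succAbove (S'.orderEmbOfFin rfl j) = (S'.map (Fin.succAboveEmb p)).orderEmbOfFin (card_map _) j :=
    congrFun e2 j
  rw [e1, ← e2']
  rfl

/-- The complement of a singleton: `E(g|{p}ᶜ) = E_n(p.removeNth g)`. [folklore] -/
theorem subfamily_compl_singleton (μ : α → ℝ) {n : ℕ} (p : Fin (n + 1)) (g : Fin (n + 1) → α → ℝ) :
    sahiE μ (({p} : Finset (Fin (n + 1)))ᶜ).card
        (fun j => g ((({p} : Finset (Fin (n + 1)))ᶜ).orderEmbOfFin rfl j))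
      = sahiE μ n (p.removeNth g) := by
  have hc : n = (({p} : Finset (Fin (n + 1)))ᶜ).card := by simp [card_compl]
  rw [← sahiE_cast μ hc]
  congr 1
  funext j
  rw [Finset.orderEmbOfFin_compl_singleton_apply]
  rfl

/-- **Bridge to the enumeration-free form.**  For nonempty `S`, `E(g|S)` (increasing enumeration) is Lieb–Sahi's cycle sum of the
family `(g_j)_{j ∈ S}` indexed by the subtype (`CycleForm.cycleSum`, `Literature/…/Sahi2008/FixedCycle.lean`); in particular it does
not depend on the enumeration. [folklore] -/
theorem subfamily_eq_cycleSum (μ : α → ℝ) {N : ℕ} (S : Finset (Fin N)) (hS : S.Nonempty) (g : Fin N → α → ℝ) :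
    sahiE μ S.card (fun j => g (S.orderEmbOfFin rfl j)) = CycleForm.cycleSum μ (fun j : {x // x ∈ S} => g j) := by
  rw [CycleForm.sahiE_eq_cycleSum μ (Finset.card_pos.mpr hS),
    ← CycleForm.cycleSum_comp_equiv μ (S.orderIsoOfFin rfl).toEquiv (fun j : {x // x ∈ S} => g j)]
  rfl

/-! ### Index bookkeeping: blocks through a pivot `p` -/

/-- `p.succAbove z ∈ S'.map (succAboveEmb p) ↔ z ∈ S'`. [folklore] -/
theorem succAbove_mem_map_succAboveEmb {n : ℕ} (p : Fin (n + 1)) (S' : Finset (Fin n)) (z : Fin n) :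
    p.succAbove z ∈ S'.map (Fin.succAboveEmb p) ↔ z ∈ S' :=
  Finset.mem_map' (Fin.succAboveEmb p)

/-- `p ∉ S'.map (succAboveEmb p)`. [folklore] -/
theorem not_mem_map_succAboveEmb {n : ℕ} (p : Fin (n + 1)) (S' : Finset (Fin n)) :
    p ∉ S'.map (Fin.succAboveEmb p) := by
  intro h
  obtain ⟨z, _, hz⟩ := Finset.mem_map.mp h
  exact Fin.succAbove_ne p z hz

/-- The complement of `insert p (S'.map (succAboveEmb p))` is `S'ᶜ.map (succAboveEmb p)`. [folklore] -/
theorem compl_insert_map_succAboveEmb {n : ℕ} (p : Fin (n + 1)) (S' : Finset (Fin n)) :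
    (insert p (S'.map (Fin.succAboveEmb p)))ᶜ = S'ᶜ.map (Fin.succAboveEmb p) := by
  ext k
  rw [mem_compl, mem_insert, not_or]
  constructor
  · rintro ⟨hk, hk'⟩
    obtain ⟨z, rfl⟩ := Fin.exists_succAbove_eq hk
    rw [succAbove_mem_map_succAboveEmb] at hk'
    exact (succAbove_mem_map_succAboveEmb p _ z).mpr (mem_compl.mpr hk')
  · intro hk
    obtain ⟨z, hz, rfl⟩ := Finset.mem_map.mp hk
    refine ⟨Fin.succAbove_ne p z, ?_⟩
    rw [Fin.coe_succAboveEmb, succAbove_mem_map_succAboveEmb]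
    exact mem_compl.mp hz

/-- **Re-indexing the blocks through the pivot `p`.**  The blocks `T' ≠ univ` of `p.removeNth g`, joined with `g p`, are the blocks
`T ∋ p`, `T ≠ univ` of `g` (`T = insert p (T'.map (succAboveEmb p))`, `|T| = |T'| + 1`, same complementary sub-family). [this file] -/
theorem sum_blocks_succAbove (μ : α → ℝ) {n : ℕ} (p : Fin (n + 1)) (x : α → ℝ) (g : Fin (n + 1) → α → ℝ) :
    ∑ T' : Finset (Fin n) with T' ≠ univ,
        ((T'.card)! : ℝ) * (ex μ ((g p * x) * ∏ j ∈ T', p.removeNth g j)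
          * sahiE μ T'ᶜ.card (fun j => p.removeNth g (T'ᶜ.orderEmbOfFin rfl j)))
      = ∑ T : Finset (Fin (n + 1)) with (p ∈ T ∧ T ≠ univ),
        (((T.card - 1))! : ℝ) * (ex μ (x * ∏ j ∈ T, g j)
          * sahiE μ Tᶜ.card (fun j => g (Tᶜ.orderEmbOfFin rfl j))) := by
  refine Finset.sum_nbij' (fun T' => insert p (T'.map (Fin.succAboveEmb p)))
    (fun T => univ.filter (fun z => p.succAbove z ∈ T)) ?_ ?_ ?_ ?_ ?_
  · -- into the target index set
    intro T' hT'
    have hT'ne : T' ≠ univ := (Finset.mem_filter.mp hT').2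
    rw [Finset.mem_filter]
    refine ⟨mem_univ _, mem_insert_self _ _, ?_⟩
    intro hU
    obtain ⟨z, hz⟩ : ∃ z, z ∉ T' := not_forall.mp fun h => hT'ne (eq_univ_of_forall h)
    have hmem : p.succAbove z ∈ insert p (T'.map (Fin.succAboveEmb p)) := by rw [hU]; exact mem_univ _
    rw [mem_insert, succAbove_mem_map_succAboveEmb] at hmem
    rcases hmem with h | h
    · exact Fin.succAbove_ne p z h
    · exact hz h
  · -- back into the source index set
    intro T hT
    have hp : p ∈ T := (Finset.mem_filter.mp hT).2.1
    have hTne : T ≠ univ := (Finset.mem_filter.mp hT).2.2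
    rw [Finset.mem_filter]
    refine ⟨mem_univ _, ?_⟩
    intro hU
    apply hTne
    refine eq_univ_of_forall fun k => ?_
    by_cases hk : k = p
    · rw [hk]; exact hp
    · obtain ⟨z, rfl⟩ := Fin.exists_succAbove_eq hk
      have hz : z ∈ univ.filter (fun z => p.succAbove z ∈ T) := by rw [hU]; exact mem_univ _
      exact (Finset.mem_filter.mp hz).2
  · -- left inverse
    intro T' _
    ext z
    simp only [Finset.mem_filter, mem_univ, true_and, mem_insert, succAbove_mem_map_succAboveEmb]
    constructor
    · rintro (h | h)
      · exact absurd h (Fin.succAbove_ne p z)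
      · exact h
    · exact fun h => Or.inr h
  · -- right inverse
    intro T hT
    have hp : p ∈ T := (Finset.mem_filter.mp hT).2.1
    ext k
    simp only [mem_insert, Finset.mem_map, Finset.mem_filter, mem_univ, true_and, Fin.coe_succAboveEmb]
    constructor
    · rintro (rfl | ⟨z, hz, rfl⟩)
      · exact hp
      · exact hz
    · intro hk
      by_cases hkp : k = p
      · exact Or.inl hkp
      · obtain ⟨z, rfl⟩ := Fin.exists_succAbove_eq hkp
        exact Or.inr ⟨z, hk, rfl⟩
  · -- the summands agree
    intro T' _
    have hnot := not_mem_map_succAboveEmb p T'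
    have hcard : (insert p (T'.map (Fin.succAboveEmb p))).card - 1 = T'.card := by
      rw [card_insert_of_notMem hnot, card_map]
      rfl
    rw [hcard]
    congr 1
    have hprod : (g p * x) * ∏ j ∈ T', p.removeNth g j
        = x * ∏ j ∈ insert p (T'.map (Fin.succAboveEmb p)), g j := by
      rw [prod_insert hnot, prod_map]
      simp only [Fin.removeNth, Fin.coe_succAboveEmb]
      ring
    have hsub : sahiE μ (insert p (T'.map (Fin.succAboveEmb p)))ᶜ.card
          (fun j => g ((insert p (T'.map (Fin.succAboveEmb p)))ᶜ.orderEmbOfFin rfl j))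
        = sahiE μ T'ᶜ.card (fun j => p.removeNth g (T'ᶜ.orderEmbOfFin rfl j)) := by
      rw [subfamily_congr μ (compl_insert_map_succAboveEmb p T') g, subfamily_map_succAbove]
    rw [hprod, hsub]

/-- Peeling the empty block: `Σ_{T ≠ univ} |T|!·E[x∏_T g]·E(g|Tᶜ) = E[x]·E_{m+1}(g) + Σ_{∅ ≠ T ≠ univ} (…)`. [this file] -/
theorem sum_blocks_peel_empty (μ : α → ℝ) {m : ℕ} (x : α → ℝ) (g : Fin (m + 1) → α → ℝ) :
    ∑ T : Finset (Fin (m + 1)) with T ≠ univ,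
        ((T.card)! : ℝ) * (ex μ (x * ∏ i ∈ T, g i) * sahiE μ Tᶜ.card (fun j => g (Tᶜ.orderEmbOfFin rfl j)))
      = ex μ x * sahiE μ (m + 1) g
        + ∑ T : Finset (Fin (m + 1)) with (T.Nonempty ∧ T ≠ univ),
            ((T.card)! : ℝ) * (ex μ (x * ∏ i ∈ T, g i) * sahiE μ Tᶜ.card (fun j => g (Tᶜ.orderEmbOfFin rfl j))) := by
  have hmem : (∅ : Finset (Fin (m + 1))) ∈ (univ : Finset (Finset (Fin (m + 1)))).filter (fun T => T ≠ univ) := by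
    rw [Finset.mem_filter]
    exact ⟨mem_univ _, (Finset.univ_nonempty.ne_empty).symm⟩
  rw [← Finset.add_sum_erase _ _ hmem]
  congr 1
  · rw [Finset.card_empty, Nat.factorial_zero, Nat.cast_one, one_mul, Finset.prod_empty, mul_one,
      subfamily_congr μ (Finset.compl_empty) g, subfamily_univ]
  · apply Finset.sum_congr
    · ext T
      simp only [Finset.mem_erase, Finset.mem_filter, mem_univ, true_and, Finset.nonempty_iff_ne_empty]
    · intro T _
      rfl

/-! ### The moment expansion -/

/-- **Moment expansion, uniform form** (any weight, any functions, `g` of any length `m`):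
`E_{m+1}(x, g) = m!·E[x·∏ g] − Σ_{T ≠ univ} |T|!·E[x·∏_{i∈T} g_i]·E_{|Tᶜ|}(g|Tᶜ)` (the block `T = ∅` contributes `E[x]·E_m(g)`). [this file] -/
theorem sahiE_cons_eq_moment_expansion_aux (μ : α → ℝ) :
    ∀ (m : ℕ) (x : α → ℝ) (g : Fin m → α → ℝ),
      sahiE μ (m + 1) (Fin.cons x g : Fin (m + 1) → α → ℝ)
        = (m ! : ℝ) * ex μ (x * ∏ i, g i)
          - ∑ T : Finset (Fin m) with T ≠ univ,
              ((T.card)! : ℝ) * (ex μ (x * ∏ i ∈ T, g i)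
                * sahiE μ Tᶜ.card (fun j => g (Tᶜ.orderEmbOfFin rfl j))) := by
  intro m
  induction m with
  | zero =>
    intro x g
    have hsum : (univ : Finset (Finset (Fin 0))).filter (fun T => T ≠ univ) = ∅ := by
      refine Finset.filter_eq_empty_iff.mpr ?_
      intro T _ hT
      exact hT (by rw [Finset.eq_empty_of_isEmpty T, Finset.univ_eq_empty])
    rw [hsum, Finset.sum_empty, sub_zero, sahiE_one_apply, Fin.cons_zero, Nat.factorial_zero, Nat.cast_one,
      one_mul, Finset.univ_eq_empty, Finset.prod_empty, mul_one]
  | succ m ih =>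
    intro x g
    show sahiE μ (m + 2) (Fin.cons x g : Fin (m + 2) → α → ℝ) = _
    rw [sahiE_fin_cons]
    have hterm : ∀ p : Fin (m + 1), sahiE μ (m + 1) (update g p (g p * x))
        = (m ! : ℝ) * ex μ (x * ∏ i, g i)
          - ∑ T : Finset (Fin (m + 1)) with (p ∈ T ∧ T ≠ univ),
              (((T.card - 1))! : ℝ) * (ex μ (x * ∏ j ∈ T, g j)
                * sahiE μ Tᶜ.card (fun j => g (Tᶜ.orderEmbOfFin rfl j))) := by
      intro p
      have hx : (g p * x) * ∏ i, p.removeNth g i = x * ∏ i, g i := by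
        funext a
        simp only [Pi.mul_apply, Finset.prod_apply, Fin.removeNth, Fin.prod_univ_succAbove (fun i => g i a) p]
        ring
      rw [SahiMeetTowerAll.sahiE_update_eq_sahiE_cons, ih (g p * x) (p.removeNth g), hx,
        sum_blocks_succAbove]
    simp only [hterm]
    rw [Finset.sum_sub_distrib, Finset.sum_const, Finset.card_univ, Fintype.card_fin, nsmul_eq_mul]
    have hDS : ∑ p : Fin (m + 1), ∑ T : Finset (Fin (m + 1)) with (p ∈ T ∧ T ≠ univ),
          (((T.card - 1))! : ℝ) * (ex μ (x * ∏ j ∈ T, g j)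
            * sahiE μ Tᶜ.card (fun j => g (Tᶜ.orderEmbOfFin rfl j)))
        = ∑ T : Finset (Fin (m + 1)) with (T.Nonempty ∧ T ≠ univ),
          ((T.card)! : ℝ) * (ex μ (x * ∏ i ∈ T, g i)
            * sahiE μ Tᶜ.card (fun j => g (Tᶜ.orderEmbOfFin rfl j))) := by
      rw [Finset.sum_comm' (s := (univ : Finset (Fin (m + 1))))
        (t := fun p => (univ : Finset (Finset (Fin (m + 1)))).filter (fun T => p ∈ T ∧ T ≠ univ))
        (t' := (univ : Finset (Finset (Fin (m + 1)))).filter (fun T => T.Nonempty ∧ T ≠ univ))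
        (s' := fun T => T) ?_]
      · refine Finset.sum_congr rfl fun T hT => ?_
        have hne : T.Nonempty := (Finset.mem_filter.mp hT).2.1
        rw [Finset.sum_const, nsmul_eq_mul, ← mul_assoc]
        congr 1
        have h := Nat.mul_factorial_pred (Finset.card_pos.mpr hne).ne'
        exact_mod_cast h
      · intro p T
        simp only [Finset.mem_filter, mem_univ, true_and]
        exact ⟨fun ⟨hp, hT⟩ => ⟨hp, ⟨p, hp⟩, hT⟩, fun ⟨hp, _, hT⟩ => ⟨hp, hT⟩⟩
    rw [hDS, sum_blocks_peel_empty]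
    push_cast [Nat.factorial_succ]
    ring

/-- **Moment expansion of `E_{m+2}` in the head slot** (any weight `μ`, any functions): for `x` and `g_0,…,g_m`,
`E_{m+2}(x, g) = (m+1)!·E[x·∏_i g_i] − E[x]·E_{m+1}(g) − Σ_{∅ ≠ T ⊊ univ} |T|!·E[x·∏_{i∈T} g_i]·E_{|Tᶜ|}(g|Tᶜ)`,
where `g|Tᶜ` is the sub-family indexed by `Tᶜ` in increasing order (the value does not depend on the order, by symmetry of `E_n`).
This is Sahi's set-partition formula peeled at the block containing `x`; proved here from the Lieb–Sahi recursion and symmetry. [this file] -/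
theorem sahiE_cons_eq_moment_expansion (μ : α → ℝ) (m : ℕ) (x : α → ℝ) (g : Fin (m + 1) → α → ℝ) :
    sahiE μ (m + 2) (Fin.cons x g : Fin (m + 2) → α → ℝ)
      = ((m + 1)! : ℝ) * ex μ (x * ∏ i, g i) - ex μ x * sahiE μ (m + 1) g
        - ∑ T : Finset (Fin (m + 1)) with (T.Nonempty ∧ T ≠ univ),
            ((T.card)! : ℝ) * (ex μ (x * ∏ i ∈ T, g i)
              * sahiE μ Tᶜ.card (fun j => g (Tᶜ.orderEmbOfFin rfl j))) := by
  rw [sahiE_cons_eq_moment_expansion_aux μ (m + 1) x g, sum_blocks_peel_empty]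
  ring

/-- Unnormalised branching: `E_{m+2}(1, g) = (m + 1 − E[1])·E_{m+1}(g)` (any weight; `= m·E_{m+1}(g)` for a probability weight,
Sahi's Theorem 6). [folklore] -/
theorem sahiE_one_cons_eq (μ : α → ℝ) (m : ℕ) (g : Fin (m + 1) → α → ℝ) :
    sahiE μ (m + 2) (Fin.cons (1 : α → ℝ) g : Fin (m + 2) → α → ℝ) = (((m : ℝ) + 1) - ex μ 1) * sahiE μ (m + 1) g := by
  rw [sahiE_fin_cons]
  simp only [mul_one, update_eq_self, Finset.sum_const, Finset.card_univ, Fintype.card_fin, nsmul_eq_mul]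
  push_cast
  ring

/-- **Moment recursion** (any weight, any functions): `(m+1)·E_{m+1}(g) = (m+1)!·E[∏_i g_i] − Σ_{∅ ≠ T ⊊ univ} |T|!·E[∏_{i∈T} g_i]·E_{|Tᶜ|}(g|Tᶜ)`
— `E_{m+1}` from the top moment and the lower-order functionals of the proper sub-families (the expansion at `x = 1` combined with
unnormalised branching; the `E[1]` terms cancel). [this file] -/
theorem sahiE_moment_recursion (μ : α → ℝ) (m : ℕ) (g : Fin (m + 1) → α → ℝ) :
    ((m : ℝ) + 1) * sahiE μ (m + 1) g
      = ((m + 1)! : ℝ) * ex μ (∏ i, g i)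
        - ∑ T : Finset (Fin (m + 1)) with (T.Nonempty ∧ T ≠ univ),
            ((T.card)! : ℝ) * (ex μ (∏ i ∈ T, g i)
              * sahiE μ Tᶜ.card (fun j => g (Tᶜ.orderEmbOfFin rfl j))) := by
  have h := sahiE_cons_eq_moment_expansion μ m 1 g
  rw [sahiE_one_cons_eq] at h
  simp only [one_mul] at h
  linear_combination h

end SahiMomentExpansion

end Summit.CriticalPhenomena.PercolationContinuityZ3.Theorems
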